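import Literature.AlgebraicTopology.Homotopy.CoveringSerreFibration
import Literature.AlgebraicTopology.Homotopy.FibreBundles
import Mathlib.Analysis.InnerProductSpace.PiL2
import Mathlib.Analysis.SpecialFunctions.Complex.Circle
import HarnessLib

/-!
# The Hopf fibration `S¹ → S³ → S²` and `η_* : πₙ(S³) ≅ πₙ(S²)` for `n ≥ 3`

Topic `Literature/AlgebraicTopology/Homotopy`. H. Hopf, *Über die Abbildungen der
dreidimensionalen Sphäre auf die Kugelfläche*, Math. Ann. 104 (1931), 637–665, §5 (the map
`(z, w) ↦ (2 z w̄, |z|² - |w|²)` in quadratic form); A. Hatcher, *Algebraic Topology* (2002), §4.2,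
Example 4.45 ("the projection `S³ → S²` is a fiber bundle with fiber `S¹` … the long exact
sequence … gives `πₙ(S³) ≈ πₙ(S²)` for `n ≥ 3`"), Thm. 4.41, Prop. 4.48.

For the metric unit spheres `Sⁿ ⊂ ℝⁿ⁺¹ = EuclideanSpace ℝ (Fin (n+1))` of the tree (the spheres of
`FreudenthalSuspension.lean`) this file DEFINES the Hopf map and PROVES that it is a fibre bundle
with fibre Mathlib's `Circle`, by two explicit local sections:

* `HopfFibration.hopf : C(S³, S²)`, `(z, w) ↦ (2 z w̄, |z|² - |w|²)` in the complex coordinates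
  `z = x₀ + i x₁`, `w = x₂ + i x₃` of `ℝ⁴` and `ℝ³ = ℂ × ℝ`; the circle action `act u (z, w) =
  (uz, uw)` with `hopf_act : η(u · x) = η x`;
* the local sections `s₁(ξ, t) = (a, ξ̄/(2a))`, `a = √((1+t)/2)`, over `V₁ = {t > -1}` and
  `s₂(ξ, t) = (ξ/(2a'), a')`, `a' = √((1-t)/2)`, over `V₂ = {t < 1}`, and the trivialisations
  `x ↦ (η x, z/|z|)`, resp. `(η x, w/|w|)`, with inverses `(y, u) ↦ u · sᵢ(y)`:
  `HopfFibration.triv₁ : η⁻¹V₁ ≃ₜ V₁ × S¹`, `HopfFibration.triv₂`;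
* **`HopfFibration.isFibreBundleWith_hopf : IsFibreBundleWith Circle hopf`**, hence
  `isSerreFibration_hopf`, `nonempty_fibre_homeomorph` (the fibres are circles);
* `Circle.subsingleton_homotopyGroup` (`πₙ(S¹) = 0`, `n ≥ 2`, from `CoveringSerreFibration.lean`)
  and **`HopfFibration.bijective_homotopyGroupMap_hopf`**: `η_* : π_N(S³, x) → π_N(S², η x)` is a
  bijection for `|N| ≥ 3` and one-to-one for `|N| ≥ 2` (`injective_homotopyGroupMap_hopf`).

Everything is proved; no named facts.

## References

* H. Hopf, *Über die Abbildungen der dreidimensionalen Sphäre auf die Kugelfläche*, Math. Ann.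
  104 (1931), 637–665.
* A. Hatcher, *Algebraic Topology*, CUP (2002), §4.2 Example 4.45, Thm. 4.41, Prop. 4.48;
  Prop. 4.1. [HatcherAT2002]
-/

noncomputable section

open Complex ComplexConjugate Metric Function
open scoped Topology

namespace Literature.AlgebraicTopology.Homotopy

namespace HopfFibration

/-- Local notation: `𝔼 n` is `EuclideanSpace ℝ (Fin n)`. -/
local notation "𝔼" n:arg => EuclideanSpace ℝ (Fin n)

/-- Local notation: `𝕊 n` is the unit sphere of `EuclideanSpace ℝ (Fin (n + 1))`. -/
local notation "𝕊" n:arg => (Metric.sphere (0 : EuclideanSpace ℝ (Fin (n + 1))) 1)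

/-! ### Complex coordinates on `ℝ⁴` and the Hopf map -/


/-- The first complex coordinate `z = x₀ + i x₁` of `ℝ⁴ = ℂ²`. [folklore] -/
def zC (x : 𝔼 4) : ℂ := ⟨x 0, x 1⟩
/-- The second complex coordinate `w = x₂ + i x₃` of `ℝ⁴ = ℂ²`. [folklore] -/
def wC (x : 𝔼 4) : ℂ := ⟨x 2, x 3⟩

/-- `z` is continuous. [folklore] -/
theorem continuous_zC : Continuous zC := by
  have h : zC = fun x : 𝔼 4 => (x 0 : ℂ) + (x 1 : ℂ) * I := by
    funext x; apply Complex.ext <;> simp [zC]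
  rw [h]; fun_prop

/-- `w` is continuous. [folklore] -/
theorem continuous_wC : Continuous wC := by
  have h : wC = fun x : 𝔼 4 => (x 2 : ℂ) + (x 3 : ℂ) * I := by
    funext x; apply Complex.ext <;> simp [wC]
  rw [h]; fun_prop

/-- The point of `ℝ⁴` with complex coordinates `(z, w)`. [folklore] -/
def ofZW (z w : ℂ) : 𝔼 4 := WithLp.toLp 2 ![z.re, z.im, w.re, w.im]

/-- Coordinate `0` of `ofZW`. [folklore] -/
@[simp] theorem ofZW_apply0 (z w : ℂ) : ofZW z w 0 = z.re := rfl
/-- Coordinate `1` of `ofZW`. [folklore] -/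
@[simp] theorem ofZW_apply1 (z w : ℂ) : ofZW z w 1 = z.im := rfl
/-- Coordinate `2` of `ofZW`. [folklore] -/
@[simp] theorem ofZW_apply2 (z w : ℂ) : ofZW z w 2 = w.re := rfl
/-- Coordinate `3` of `ofZW`. [folklore] -/
@[simp] theorem ofZW_apply3 (z w : ℂ) : ofZW z w 3 = w.im := rfl

/-- `z (z, w) = z`. [folklore] -/
@[simp] theorem zC_ofZW (z w : ℂ) : zC (ofZW z w) = z := Complex.ext rfl rfl
/-- `w (z, w) = w`. [folklore] -/
@[simp] theorem wC_ofZW (z w : ℂ) : wC (ofZW z w) = w := Complex.ext rfl rfl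
/-- `(z x, w x) = x`. [folklore] -/
theorem ofZW_zC_wC (x : 𝔼 4) : ofZW (zC x) (wC x) = x := by
  ext i; fin_cases i <;> rfl

/-- `ofZW` is jointly continuous. [folklore] -/
theorem continuous_ofZW : Continuous fun p : ℂ × ℂ => ofZW p.1 p.2 := by
  unfold ofZW
  refine (PiLp.continuous_toLp 2 _).comp ?_
  refine continuous_pi fun i => ?_
  fin_cases i
  · exact Complex.continuous_re.comp continuous_fst
  · exact Complex.continuous_im.comp continuous_fst
  · exact Complex.continuous_re.comp continuous_snd
  · exact Complex.continuous_im.comp continuous_snd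

/-- `‖x‖² = |z|² + |w|²` on `ℝ⁴`. [folklore] -/
theorem norm_sq_eq (x : 𝔼 4) : ‖x‖ ^ 2 = normSq (zC x) + normSq (wC x) := by
  rw [EuclideanSpace.norm_eq, Real.sq_sqrt (Finset.sum_nonneg fun _ _ => sq_nonneg _)]
  simp [Fin.sum_univ_four, normSq_apply, zC, wC, sq]
  ring

/-- `‖(z, w)‖² = |z|² + |w|²`. [folklore] -/
theorem norm_ofZW_sq (z w : ℂ) : ‖ofZW z w‖ ^ 2 = normSq z + normSq w := by
  rw [norm_sq_eq, zC_ofZW, wC_ofZW]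

/-- **The Hopf map on `ℝ⁴ = ℂ²`**, `(z, w) ↦ (2 z w̄, |z|² - |w|²) ∈ ℂ × ℝ = ℝ³` (Hatcher 2002, Example 4.45, in the quadratic form of H. Hopf, Math. Ann. 104 (1931), §5). [cite: HatcherAT2002, Example 4.45] -/
def hopfVec (x : 𝔼 4) : 𝔼 3 :=
  WithLp.toLp 2 ![(2 * zC x * conj (wC x)).re, (2 * zC x * conj (wC x)).im, normSq (zC x) - normSq (wC x)]

/-- The Hopf map is continuous. [folklore] -/
theorem continuous_hopfVec : Continuous hopfVec := by
  unfold hopfVec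
  refine (PiLp.continuous_toLp 2 _).comp (continuous_pi fun i => ?_)
  fin_cases i
  · exact Complex.continuous_re.comp ((continuous_const.mul continuous_zC).mul (Complex.continuous_conj.comp continuous_wC))
  · exact Complex.continuous_im.comp ((continuous_const.mul continuous_zC).mul (Complex.continuous_conj.comp continuous_wC))
  · exact (Complex.continuous_normSq.comp continuous_zC).sub (Complex.continuous_normSq.comp continuous_wC)

/-- `‖H(z, w)‖² = (|z|² + |w|²)²`. [folklore] -/
theorem norm_hopfVec_sq (x : 𝔼 4) : ‖hopfVec x‖ ^ 2 = (normSq (zC x) + normSq (wC x)) ^ 2 := by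
  rw [EuclideanSpace.norm_eq, Real.sq_sqrt (Finset.sum_nonneg fun _ _ => sq_nonneg _)]
  simp only [hopfVec, Fin.sum_univ_three, Real.norm_eq_abs, sq_abs]
  simp [normSq_apply, sq]
  ring

/-- The Hopf map sends the unit sphere to the unit sphere. [folklore] -/
theorem norm_hopfVec (x : 𝕊 3) : ‖hopfVec x‖ = 1 := by
  have h1 : ‖(x : 𝔼 4)‖ = 1 := by simp
  have h2 : normSq (zC x) + normSq (wC x) = 1 := by rw [← norm_sq_eq, h1, one_pow]
  have h3 : ‖hopfVec x‖ ^ 2 = 1 := by rw [norm_hopfVec_sq, h2, one_pow]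
  nlinarith [norm_nonneg (hopfVec x)]

/-- **The Hopf map `η : S³ → S²`** (Hatcher 2002, Example 4.45). [cite: HatcherAT2002, Example 4.45] -/
def hopf : C(𝕊 3, 𝕊 2) :=
  ⟨fun x => ⟨hopfVec x, by simp [norm_hopfVec x]⟩,
    (continuous_hopfVec.comp continuous_subtype_val).subtype_mk fun x => by simp [norm_hopfVec x]⟩

/-- `η` on points. [folklore] -/
@[simp] theorem coe_hopf (x : 𝕊 3) : (hopf x : 𝔼 3) = hopfVec x := rfl

/-- `|z|² + |w|² = 1` on `S³`. [folklore] -/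
theorem normSq_add_normSq (x : 𝕊 3) : normSq (zC x) + normSq (wC x) = 1 := by
  have h1 : ‖(x : 𝔼 4)‖ = 1 := by simp
  rw [← norm_sq_eq, h1, one_pow]

/-- `(z, w) ∈ S³` when `|z|² + |w|² = 1`. [folklore] -/
theorem mem_sphere_ofZW {z w : ℂ} (h : normSq z + normSq w = 1) : ofZW z w ∈ (𝕊 3) := by
  have h2 : ‖ofZW z w‖ ^ 2 = 1 := by rw [norm_ofZW_sq, h]
  have h3 : ‖ofZW z w‖ = 1 := by nlinarith [norm_nonneg (ofZW z w)]
  simp [h3]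

/-! ### The circle action -/

/-- **The circle action** `u · (z, w) = (uz, uw)` on `S³`, whose orbits are the fibres of `η` (Hatcher 2002, Example 4.45). [cite: HatcherAT2002, Example 4.45] -/
def act (u : Circle) (x : 𝕊 3) : 𝕊 3 :=
  ⟨ofZW (u * zC x) (u * wC x), mem_sphere_ofZW (by
    rw [normSq_mul, normSq_mul, Circle.normSq_coe, one_mul, one_mul, normSq_add_normSq])⟩

/-- The circle action is jointly continuous. [folklore] -/
theorem continuous_act : Continuous fun p : Circle × (𝕊 3) => act p.1 p.2 := by
  unfold act
  refine Continuous.subtype_mk ?_ _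
  have hz : Continuous fun p : Circle × (𝕊 3) => (p.1 : ℂ) * zC p.2 :=
    (continuous_subtype_val.comp continuous_fst).mul (continuous_zC.comp (continuous_subtype_val.comp continuous_snd))
  have hw : Continuous fun p : Circle × (𝕊 3) => (p.1 : ℂ) * wC p.2 :=
    (continuous_subtype_val.comp continuous_fst).mul (continuous_wC.comp (continuous_subtype_val.comp continuous_snd))
  exact continuous_ofZW.comp (hz.prodMk hw)

/-- The Hopf map in complex coordinates. [folklore] -/
theorem hopfVec_ofZW (z w : ℂ) :
    hopfVec (ofZW z w) = WithLp.toLp 2 ![(2 * z * conj w).re, (2 * z * conj w).im, normSq z - normSq w] := by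
  simp [hopfVec]

/-- **`η` is constant on the orbits of the circle action**: `η(uz, uw) = η(z, w)`. [cite: HatcherAT2002, Example 4.45] -/
theorem hopf_act (u : Circle) (x : 𝕊 3) : hopf (act u x) = hopf x := by
  apply Subtype.ext
  show hopfVec (ofZW (u * zC x) (u * wC x)) = hopfVec x
  conv_rhs => rw [← ofZW_zC_wC (x : 𝔼 4)]
  rw [hopfVec_ofZW, hopfVec_ofZW]
  have hu : (u : ℂ) * conj (u : ℂ) = 1 := by
    rw [mul_conj, Circle.normSq_coe]; simp
  have h1 : 2 * (↑u * zC ↑x) * conj (↑u * wC ↑x) = 2 * zC x * conj (wC x) := by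
    rw [map_mul]; linear_combination (2 * zC x * conj (wC x)) * hu
  have h2 : normSq (↑u * zC ↑x) - normSq (↑u * wC ↑x) = normSq (zC x) - normSq (wC x) := by
    rw [normSq_mul, normSq_mul, Circle.normSq_coe, one_mul, one_mul]
  rw [h1, h2]

/-! ### The chart over `V₁ = {t > -1}` (where `z ≠ 0`) -/

/-- The open set `V₁ = {t > -1} = S² ∖ {(0, 0, -1)}` of the base (over which `z ≠ 0`). [folklore] -/
def V₁ : Set (𝕊 2) := {y | -1 < (y : 𝔼 3) 2}

/-- `V₁` is open. [folklore] -/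
theorem isOpen_V₁ : IsOpen V₁ :=
  isOpen_lt continuous_const ((PiLp.continuous_apply 2 _ 2).comp continuous_subtype_val)

/-- The complex coordinate `ξ = y₀ + i y₁` of `ℝ³ = ℂ × ℝ`. [folklore] -/
def ξC (y : 𝔼 3) : ℂ := ⟨y 0, y 1⟩

/-- `ξ` is continuous. [folklore] -/
theorem continuous_ξC : Continuous ξC := by
  have h : ξC = fun y : 𝔼 3 => (y 0 : ℂ) + (y 1 : ℂ) * I := by
    funext y; apply Complex.ext <;> simp [ξC]
  rw [h]; fun_prop

/-- `|ξ|² = 1 - t²` on `S²`. [folklore] -/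
theorem normSq_ξC (y : 𝕊 2) : normSq (ξC y) = 1 - ((y : 𝔼 3) 2) ^ 2 := by
  have h1 : ‖(y : 𝔼 3)‖ = 1 := by simp
  have h2 : ‖(y : 𝔼 3)‖ ^ 2 = ((y : 𝔼 3) 0) ^ 2 + ((y : 𝔼 3) 1) ^ 2 + ((y : 𝔼 3) 2) ^ 2 := by
    rw [EuclideanSpace.norm_eq, Real.sq_sqrt (Finset.sum_nonneg fun _ _ => sq_nonneg _)]
    simp [Fin.sum_univ_three]
  rw [h1, one_pow] at h2
  simp only [normSq_apply, ξC]
  nlinarith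

/-- `a(y) = √((1 + t)/2)`, the modulus of `z` along the fibre over `y = (ξ, t)`. [folklore] -/
def aR (y : 𝔼 3) : ℝ := Real.sqrt ((1 + y 2) / 2)

/-- `a` is continuous. [folklore] -/
theorem continuous_aR : Continuous aR :=
  Real.continuous_sqrt.comp ((continuous_const.add (PiLp.continuous_apply 2 _ 2)).div_const _)

/-- `a > 0` over `V₁`. [folklore] -/
theorem aR_pos {y : 𝕊 2} (hy : y ∈ V₁) : 0 < aR y := Real.sqrt_pos.2 (by unfold V₁ at hy; simp only [Set.mem_setOf_eq] at hy; linarith)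

/-- `a² = (1 + t)/2` over `V₁`. [folklore] -/
theorem aR_sq {y : 𝕊 2} (hy : y ∈ V₁) : aR y ^ 2 = (1 + (y : 𝔼 3) 2) / 2 :=
  Real.sq_sqrt (by unfold V₁ at hy; simp only [Set.mem_setOf_eq] at hy; linarith)

/-- **The local section over `V₁`**: `s₁(ξ, t) = (a, ξ̄/(2a))`, `a = √((1+t)/2)` (`z` real positive). [cite: HatcherAT2002, Example 4.45] -/
def secVec₁ (y : 𝔼 3) : 𝔼 4 := ofZW (aR y) (conj (ξC y) / (2 * aR y))

/-- `s₁` lands in `S³`. [folklore] -/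
theorem secVec₁_mem {y : 𝕊 2} (hy : y ∈ V₁) : secVec₁ y ∈ (𝕊 3) := by
  apply mem_sphere_ofZW
  have ha := aR_pos hy
  have ha2 := aR_sq hy
  have hξ := normSq_ξC y
  have ht : -1 < (y : 𝔼 3) 2 := hy
  rw [normSq_div, normSq_conj, normSq_ofReal, hξ]
  have h2a : normSq (2 * (aR y : ℂ)) = 4 * aR y ^ 2 := by
    rw [normSq_mul, normSq_ofReal]; norm_num [normSq_apply]; ring
  rw [h2a]
  have hne : (1 + (y : 𝔼 3) 2) ≠ 0 := by linarith
  field_simp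
  linear_combination (4 * aR y ^ 2 + 2 * (y : 𝔼 3) 2 - 2) * ha2

/-- `η ∘ s₁ = id` on `V₁`. [folklore] -/
theorem hopfVec_secVec₁ {y : 𝕊 2} (hy : y ∈ V₁) : hopfVec (secVec₁ y) = y := by
  have ha := aR_pos hy
  have ha2 := aR_sq hy
  have hξ := normSq_ξC y
  have hne : (aR y : ℂ) ≠ 0 := by exact_mod_cast ha.ne'
  unfold secVec₁
  rw [hopfVec_ofZW]
  have h1 : 2 * (aR y : ℂ) * conj (conj (ξC y) / (2 * aR y)) = ξC y := by
    rw [map_div₀, conj_conj, map_mul, conj_ofReal]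
    have : conj (2 : ℂ) = 2 := map_ofNat _ 2
    rw [this]; field_simp
  have h2 : normSq (aR y : ℂ) - normSq (conj (ξC y) / (2 * aR y)) = (y : 𝔼 3) 2 := by
    rw [normSq_div, normSq_conj, normSq_ofReal, hξ]
    have h2a : normSq (2 * (aR y : ℂ)) = 4 * aR y ^ 2 := by
      rw [normSq_mul, normSq_ofReal]; norm_num [normSq_apply]; ring
    rw [h2a]
    have hne' : (1 + (y : 𝔼 3) 2) ≠ 0 := by have : -1 < (y : 𝔼 3) 2 := hy; linarith
    field_simp
    linear_combination (4 * aR y ^ 2 + 2 - 2 * (y : 𝔼 3) 2) * ha2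
  rw [h1, h2]
  ext i
  fin_cases i <;> simp [ξC]

/-! ### Coordinates of `hopf x` -/

/-- The last coordinate of `η(z, w)` is `|z|² - |w|²`. [folklore] -/
theorem hopf_apply2 (x : 𝕊 3) : (hopf x : 𝔼 3) 2 = normSq (zC x) - normSq (wC x) := rfl

/-- The complex coordinate of `η(z, w)` is `2 z w̄`. [folklore] -/
theorem ξC_hopf (x : 𝕊 3) : ξC (hopf x) = 2 * zC x * conj (wC x) := Complex.ext rfl rfl

/-- `|z|² = (1 + t)/2` along the fibre over `(ξ, t)`. [folklore] -/
theorem normSq_zC_eq (x : 𝕊 3) : normSq (zC x) = (1 + (hopf x : 𝔼 3) 2) / 2 := by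
  rw [hopf_apply2]; linarith [normSq_add_normSq x]

/-- `|w|² = (1 - t)/2` along the fibre over `(ξ, t)`. [folklore] -/
theorem normSq_wC_eq (x : 𝕊 3) : normSq (wC x) = (1 - (hopf x : 𝔼 3) 2) / 2 := by
  rw [hopf_apply2]; linarith [normSq_add_normSq x]

/-- `a(η x) = |z(x)|`. [folklore] -/
theorem aR_hopf (x : 𝕊 3) : aR (hopf x) = ‖zC x‖ := by
  unfold aR
  rw [← normSq_zC_eq, normSq_eq_norm_sq, Real.sqrt_sq (norm_nonneg _)]

/-- The local section over `V₁` as a map into `S³`. [folklore] -/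
def sec₁ (y : V₁) : 𝕊 3 := ⟨secVec₁ y, secVec₁_mem y.2⟩

/-- `η ∘ s₁ = id`. [folklore] -/
theorem hopf_sec₁ (y : V₁) : hopf (sec₁ y) = y := Subtype.ext (hopfVec_secVec₁ y.2)

/-- `s₁` is continuous. [folklore] -/
theorem continuous_sec₁ : Continuous sec₁ := by
  refine Continuous.subtype_mk ?_ _
  show Continuous fun y : V₁ => secVec₁ (y : 𝕊 2)
  unfold secVec₁
  have ha : Continuous fun y : V₁ => (aR ((y : 𝕊 2) : 𝔼 3) : ℂ) :=
    continuous_ofReal.comp (continuous_aR.comp (continuous_subtype_val.comp continuous_subtype_val))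
  have hξ : Continuous fun y : V₁ => conj (ξC ((y : 𝕊 2) : 𝔼 3)) :=
    continuous_conj.comp (continuous_ξC.comp (continuous_subtype_val.comp continuous_subtype_val))
  refine continuous_ofZW.comp (ha.prodMk (hξ.div (continuous_const.mul ha) fun y => ?_))
  have h1 : (aR ((y : 𝕊 2) : 𝔼 3) : ℂ) ≠ 0 := by exact_mod_cast (aR_pos y.2).ne'
  exact mul_ne_zero two_ne_zero h1

/-! ### The phase of a nonzero complex number -/

/-- The phase `z/|z| ∈ S¹` of a nonzero complex number. [folklore] -/
def phase (z : ℂ) (hz : z ≠ 0) : Circle :=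
  ⟨(‖z‖ : ℂ)⁻¹ * z, by
    simp [Submonoid.unitSphere, norm_ne_zero_iff.2 hz]⟩

/-- `phase` as a complex number. [folklore] -/
@[simp] theorem coe_phase (z : ℂ) (hz : z ≠ 0) : (phase z hz : ℂ) = (‖z‖ : ℂ)⁻¹ * z := rfl

/-- `phase` does not depend on the proof of `z ≠ 0`. [folklore] -/
theorem phase_congr {z z' : ℂ} (h : z = z') (hz : z ≠ 0) : phase z hz = phase z' (h ▸ hz) := by
  subst h; rfl

/-- `(z/|z|) · |z| = z`. [folklore] -/
theorem phase_mul_norm (z : ℂ) (hz : z ≠ 0) : (phase z hz : ℂ) * (‖z‖ : ℂ) = z := by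
  rw [coe_phase]
  have : (‖z‖ : ℂ) ≠ 0 := by exact_mod_cast norm_ne_zero_iff.2 hz
  field_simp

/-- The phase of `u a`, `u ∈ S¹`, `a > 0`, is `u`. [folklore] -/
theorem phase_mul_ofReal (u : Circle) {a : ℝ} (ha : 0 < a) (h : (u : ℂ) * a ≠ 0) :
    phase ((u : ℂ) * a) h = u := by
  apply Circle.ext
  rw [coe_phase, norm_mul, Circle.norm_coe, one_mul, Complex.norm_of_nonneg ha.le]
  have : (a : ℂ) ≠ 0 := by exact_mod_cast ha.ne'
  field_simp

/-! ### The chart over `V₁` -/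

/-- `z ≠ 0` over `V₁`. [folklore] -/
theorem zC_ne_zero {x : 𝕊 3} (hx : hopf x ∈ V₁) : zC x ≠ 0 := by
  intro h
  have h1 := normSq_zC_eq x
  rw [h, map_zero] at h1
  have : -1 < (hopf x : 𝔼 3) 2 := hx
  linarith

/-- The trivialisation `η⁻¹V₁ → V₁ × S¹`, `x ↦ (η x, z/|z|)`. [cite: HatcherAT2002, Example 4.45] -/
def triv₁Fun (x : ↥(hopf ⁻¹' V₁)) : ↥V₁ × Circle :=
  (⟨hopf x, x.2⟩, phase (zC x) (zC_ne_zero x.2))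

/-- Its inverse `V₁ × S¹ → η⁻¹V₁`, `(y, u) ↦ u · s₁(y)`. [cite: HatcherAT2002, Example 4.45] -/
def triv₁Inv (q : ↥V₁ × Circle) : ↥(hopf ⁻¹' V₁) :=
  ⟨act q.2 (sec₁ q.1), by
    show hopf (act q.2 (sec₁ q.1)) ∈ V₁
    rw [hopf_act, hopf_sec₁]; exact q.1.2⟩

/-- `(y, u) ↦ u · s₁(y)` is a left inverse of `x ↦ (η x, z/|z|)`: `(z/|z|) · (|z|, z̄w/|z|) = (z, w)`. [folklore] -/
theorem triv₁_left_inv (x : ↥(hopf ⁻¹' V₁)) : triv₁Inv (triv₁Fun x) = x := by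
  apply Subtype.ext; apply Subtype.ext
  show ofZW ((phase (zC x) (zC_ne_zero x.2) : ℂ) * zC (sec₁ ⟨hopf x, x.2⟩))
      ((phase (zC x) (zC_ne_zero x.2) : ℂ) * wC (sec₁ ⟨hopf x, x.2⟩)) = (x : 𝕊 3)
  have hz := zC_ne_zero x.2
  have hzn : (‖zC x‖ : ℂ) ≠ 0 := by exact_mod_cast norm_ne_zero_iff.2 hz
  have e1 : zC (sec₁ ⟨hopf x, x.2⟩) = (‖zC x‖ : ℂ) := by
    show zC (secVec₁ (hopf x)) = _
    rw [secVec₁, zC_ofZW, aR_hopf]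
  have e2 : wC (sec₁ ⟨hopf x, x.2⟩) = conj (zC x) * wC x / (‖zC x‖ : ℂ) := by
    show wC (secVec₁ (hopf x)) = _
    rw [secVec₁, wC_ofZW, aR_hopf, ξC_hopf, map_mul, map_mul, conj_conj]
    have : conj (2 : ℂ) = 2 := map_ofNat _ 2
    rw [this]
    field_simp
  rw [e1, e2, phase_mul_norm]
  have e3 : (phase (zC x) hz : ℂ) * (conj (zC x) * wC x / (‖zC x‖ : ℂ)) = wC x := by
    rw [coe_phase]
    have hzz : zC x * conj (zC x) = ((‖zC x‖ : ℝ) : ℂ) ^ 2 := by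
      rw [mul_conj, normSq_eq_norm_sq]; push_cast; ring
    field_simp
    linear_combination (wC x) * hzz
  rw [e3]
  exact ofZW_zC_wC _

/-- … and a right inverse: `η(u · s₁ y) = y` and the phase of `u a` is `u`. [folklore] -/
theorem triv₁_right_inv (q : ↥V₁ × Circle) : triv₁Fun (triv₁Inv q) = q := by
  obtain ⟨y, u⟩ := q
  apply Prod.ext
  · apply Subtype.ext
    show hopf (act u (sec₁ y)) = y
    rw [hopf_act, hopf_sec₁]
  · have ha := aR_pos y.2
    have e1 : zC (act u (sec₁ y)) = (u : ℂ) * (aR y : ℂ) := by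
      show zC (ofZW _ _) = _
      rw [zC_ofZW]
      show (u : ℂ) * zC (secVec₁ y) = _
      rw [secVec₁, zC_ofZW]
    show phase (zC (act u (sec₁ y))) (zC_ne_zero (triv₁Inv (y, u)).2) = u
    rw [phase_congr e1, phase_mul_ofReal u ha]

/-- The trivialisation is continuous. [folklore] -/
theorem continuous_triv₁Fun : Continuous triv₁Fun := by
  refine Continuous.prodMk ?_ ?_
  · exact (hopf.continuous.comp continuous_subtype_val).subtype_mk _
  · refine Continuous.subtype_mk ?_ _
    have hz : Continuous fun x : ↥(hopf ⁻¹' V₁) => zC ((x : 𝕊 3) : 𝔼 4) :=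
      continuous_zC.comp (continuous_subtype_val.comp continuous_subtype_val)
    have hn : Continuous fun x : ↥(hopf ⁻¹' V₁) => ((‖zC ((x : 𝕊 3) : 𝔼 4)‖ : ℝ) : ℂ) :=
      continuous_ofReal.comp (continuous_norm.comp hz)
    exact (hn.inv₀ fun x => by exact_mod_cast norm_ne_zero_iff.2 (zC_ne_zero x.2)).mul hz

/-- Its inverse is continuous. [folklore] -/
theorem continuous_triv₁Inv : Continuous triv₁Inv :=
  (continuous_act.comp (continuous_snd.prodMk (continuous_sec₁.comp continuous_fst))).subtype_mk _

/-- **The local trivialisation of `η` over `V₁`**, a homeomorphism `η⁻¹V₁ ≃ₜ V₁ × S¹` over `V₁`. [cite: HatcherAT2002, Example 4.45] -/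
def triv₁ : ↥(hopf ⁻¹' V₁) ≃ₜ ↥V₁ × Circle where
  toFun := triv₁Fun
  invFun := triv₁Inv
  left_inv := triv₁_left_inv
  right_inv := triv₁_right_inv
  continuous_toFun := continuous_triv₁Fun
  continuous_invFun := continuous_triv₁Inv

/-- `triv₁` lies over `V₁`. [folklore] -/
theorem triv₁_fst (x : ↥(hopf ⁻¹' V₁)) : ((triv₁ x).1 : 𝕊 2) = hopf x := rfl

/-! ### The chart over `V₂ = {t < 1}` (where `w ≠ 0`) -/

/-- The open set `V₂ = {t < 1} = S² ∖ {(0, 0, 1)}` of the base (over which `w ≠ 0`). [folklore] -/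
def V₂ : Set (𝕊 2) := {y | (y : 𝔼 3) 2 < 1}

/-- `V₂` is open. [folklore] -/
theorem isOpen_V₂ : IsOpen V₂ :=
  isOpen_lt ((PiLp.continuous_apply 2 _ 2).comp continuous_subtype_val) continuous_const

/-- `a'(y) = √((1 - t)/2)`, the modulus of `w` along the fibre over `y = (ξ, t)`. [folklore] -/
def bR (y : 𝔼 3) : ℝ := Real.sqrt ((1 - y 2) / 2)

/-- `a'` is continuous. [folklore] -/
theorem continuous_bR : Continuous bR :=
  Real.continuous_sqrt.comp ((continuous_const.sub (PiLp.continuous_apply 2 _ 2)).div_const _)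

/-- `a' > 0` over `V₂`. [folklore] -/
theorem bR_pos {y : 𝕊 2} (hy : y ∈ V₂) : 0 < bR y := Real.sqrt_pos.2 (by unfold V₂ at hy; simp only [Set.mem_setOf_eq] at hy; linarith)

/-- `a'² = (1 - t)/2` over `V₂`. [folklore] -/
theorem bR_sq {y : 𝕊 2} (hy : y ∈ V₂) : bR y ^ 2 = (1 - (y : 𝔼 3) 2) / 2 :=
  Real.sq_sqrt (by unfold V₂ at hy; simp only [Set.mem_setOf_eq] at hy; linarith)

/-- **The local section over `V₂`**: `s₂(ξ, t) = (ξ/(2a'), a')`, `a' = √((1-t)/2)` (`w` real positive). [cite: HatcherAT2002, Example 4.45] -/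
def secVec₂ (y : 𝔼 3) : 𝔼 4 := ofZW (ξC y / (2 * bR y)) (bR y)

/-- `s₂` lands in `S³`. [folklore] -/
theorem secVec₂_mem {y : 𝕊 2} (hy : y ∈ V₂) : secVec₂ y ∈ (𝕊 3) := by
  apply mem_sphere_ofZW
  have ha := bR_pos hy
  have ha2 := bR_sq hy
  have hξ := normSq_ξC y
  have ht : (y : 𝔼 3) 2 < 1 := hy
  rw [normSq_div, normSq_ofReal, hξ]
  have h2a : normSq (2 * (bR y : ℂ)) = 4 * bR y ^ 2 := by
    rw [normSq_mul, normSq_ofReal]; norm_num [normSq_apply]; ring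
  rw [h2a]
  have hne : (1 - (y : 𝔼 3) 2) ≠ 0 := by linarith
  field_simp
  linear_combination (4 * bR y ^ 2 - 2 * (y : 𝔼 3) 2 - 2) * ha2

/-- `η ∘ s₂ = id` on `V₂`. [folklore] -/
theorem hopfVec_secVec₂ {y : 𝕊 2} (hy : y ∈ V₂) : hopfVec (secVec₂ y) = y := by
  have ha := bR_pos hy
  have ha2 := bR_sq hy
  have hξ := normSq_ξC y
  have hne : (bR y : ℂ) ≠ 0 := by exact_mod_cast ha.ne'
  unfold secVec₂
  rw [hopfVec_ofZW]
  have h1 : 2 * (ξC y / (2 * bR y)) * conj (bR y : ℂ) = ξC y := by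
    rw [conj_ofReal]; field_simp
  have h2 : normSq (ξC y / (2 * bR y)) - normSq (bR y : ℂ) = (y : 𝔼 3) 2 := by
    rw [normSq_div, normSq_ofReal, hξ]
    have h2a : normSq (2 * (bR y : ℂ)) = 4 * bR y ^ 2 := by
      rw [normSq_mul, normSq_ofReal]; norm_num [normSq_apply]; ring
    rw [h2a]
    have hne' : (1 - (y : 𝔼 3) 2) ≠ 0 := by have : (y : 𝔼 3) 2 < 1 := hy; linarith
    field_simp
    linear_combination (-(4 * bR y ^ 2) - 2 - 2 * (y : 𝔼 3) 2) * ha2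
  rw [h1, h2]
  ext i
  fin_cases i <;> simp [ξC]

/-- `a'(η x) = |w(x)|`. [folklore] -/
theorem bR_hopf (x : 𝕊 3) : bR (hopf x) = ‖wC x‖ := by
  unfold bR
  rw [← normSq_wC_eq, normSq_eq_norm_sq, Real.sqrt_sq (norm_nonneg _)]

/-- The local section over `V₂` as a map into `S³`. [folklore] -/
def sec₂ (y : V₂) : 𝕊 3 := ⟨secVec₂ y, secVec₂_mem y.2⟩

/-- `η ∘ s₂ = id`. [folklore] -/
theorem hopf_sec₂ (y : V₂) : hopf (sec₂ y) = y := Subtype.ext (hopfVec_secVec₂ y.2)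

/-- `s₂` is continuous. [folklore] -/
theorem continuous_sec₂ : Continuous sec₂ := by
  refine Continuous.subtype_mk ?_ _
  show Continuous fun y : V₂ => secVec₂ (y : 𝕊 2)
  unfold secVec₂
  have ha : Continuous fun y : V₂ => (bR ((y : 𝕊 2) : 𝔼 3) : ℂ) :=
    continuous_ofReal.comp (continuous_bR.comp (continuous_subtype_val.comp continuous_subtype_val))
  have hξ : Continuous fun y : V₂ => ξC ((y : 𝕊 2) : 𝔼 3) :=
    continuous_ξC.comp (continuous_subtype_val.comp continuous_subtype_val)
  refine continuous_ofZW.comp ((hξ.div (continuous_const.mul ha) fun y => ?_).prodMk ha)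
  have h1 : (bR ((y : 𝕊 2) : 𝔼 3) : ℂ) ≠ 0 := by exact_mod_cast (bR_pos y.2).ne'
  exact mul_ne_zero two_ne_zero h1

/-- `w ≠ 0` over `V₂`. [folklore] -/
theorem wC_ne_zero {x : 𝕊 3} (hx : hopf x ∈ V₂) : wC x ≠ 0 := by
  intro h
  have h1 := normSq_wC_eq x
  rw [h, map_zero] at h1
  have : (hopf x : 𝔼 3) 2 < 1 := hx
  linarith

/-- The trivialisation `η⁻¹V₂ → V₂ × S¹`, `x ↦ (η x, w/|w|)`. [cite: HatcherAT2002, Example 4.45] -/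
def triv₂Fun (x : ↥(hopf ⁻¹' V₂)) : ↥V₂ × Circle :=
  (⟨hopf x, x.2⟩, phase (wC x) (wC_ne_zero x.2))

/-- Its inverse `V₂ × S¹ → η⁻¹V₂`, `(y, u) ↦ u · s₂(y)`. [cite: HatcherAT2002, Example 4.45] -/
def triv₂Inv (q : ↥V₂ × Circle) : ↥(hopf ⁻¹' V₂) :=
  ⟨act q.2 (sec₂ q.1), by
    show hopf (act q.2 (sec₂ q.1)) ∈ V₂
    rw [hopf_act, hopf_sec₂]; exact q.1.2⟩

/-- `(y, u) ↦ u · s₂(y)` is a left inverse of `x ↦ (η x, w/|w|)`. [folklore] -/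
theorem triv₂_left_inv (x : ↥(hopf ⁻¹' V₂)) : triv₂Inv (triv₂Fun x) = x := by
  apply Subtype.ext; apply Subtype.ext
  show ofZW ((phase (wC x) (wC_ne_zero x.2) : ℂ) * zC (sec₂ ⟨hopf x, x.2⟩))
      ((phase (wC x) (wC_ne_zero x.2) : ℂ) * wC (sec₂ ⟨hopf x, x.2⟩)) = (x : 𝕊 3)
  have hw := wC_ne_zero x.2
  have hwn : (‖wC x‖ : ℂ) ≠ 0 := by exact_mod_cast norm_ne_zero_iff.2 hw
  have e1 : wC (sec₂ ⟨hopf x, x.2⟩) = (‖wC x‖ : ℂ) := by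
    show wC (secVec₂ (hopf x)) = _
    rw [secVec₂, wC_ofZW, bR_hopf]
  have e2 : zC (sec₂ ⟨hopf x, x.2⟩) = zC x * conj (wC x) / (‖wC x‖ : ℂ) := by
    show zC (secVec₂ (hopf x)) = _
    rw [secVec₂, zC_ofZW, bR_hopf, ξC_hopf]
    field_simp
  rw [e1, e2, phase_mul_norm]
  have e3 : (phase (wC x) hw : ℂ) * (zC x * conj (wC x) / (‖wC x‖ : ℂ)) = zC x := by
    rw [coe_phase]
    have hww : wC x * conj (wC x) = ((‖wC x‖ : ℝ) : ℂ) ^ 2 := by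
      rw [mul_conj, normSq_eq_norm_sq]; push_cast; ring
    field_simp
    linear_combination (zC x) * hww
  rw [e3]
  exact ofZW_zC_wC _

/-- … and a right inverse. [folklore] -/
theorem triv₂_right_inv (q : ↥V₂ × Circle) : triv₂Fun (triv₂Inv q) = q := by
  obtain ⟨y, u⟩ := q
  apply Prod.ext
  · apply Subtype.ext
    show hopf (act u (sec₂ y)) = y
    rw [hopf_act, hopf_sec₂]
  · have ha := bR_pos y.2
    have e1 : wC (act u (sec₂ y)) = (u : ℂ) * (bR y : ℂ) := by
      show wC (ofZW _ _) = _
      rw [wC_ofZW]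
      show (u : ℂ) * wC (secVec₂ y) = _
      rw [secVec₂, wC_ofZW]
    show phase (wC (act u (sec₂ y))) (wC_ne_zero (triv₂Inv (y, u)).2) = u
    rw [phase_congr e1, phase_mul_ofReal u ha]

/-- The trivialisation over `V₂` is continuous. [folklore] -/
theorem continuous_triv₂Fun : Continuous triv₂Fun := by
  refine Continuous.prodMk ?_ ?_
  · exact (hopf.continuous.comp continuous_subtype_val).subtype_mk _
  · refine Continuous.subtype_mk ?_ _
    have hw : Continuous fun x : ↥(hopf ⁻¹' V₂) => wC ((x : 𝕊 3) : 𝔼 4) :=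
      continuous_wC.comp (continuous_subtype_val.comp continuous_subtype_val)
    have hn : Continuous fun x : ↥(hopf ⁻¹' V₂) => ((‖wC ((x : 𝕊 3) : 𝔼 4)‖ : ℝ) : ℂ) :=
      continuous_ofReal.comp (continuous_norm.comp hw)
    exact (hn.inv₀ fun x => by exact_mod_cast norm_ne_zero_iff.2 (wC_ne_zero x.2)).mul hw

/-- Its inverse is continuous. [folklore] -/
theorem continuous_triv₂Inv : Continuous triv₂Inv :=
  (continuous_act.comp (continuous_snd.prodMk (continuous_sec₂.comp continuous_fst))).subtype_mk _

/-- **The local trivialisation of `η` over `V₂`**, `η⁻¹V₂ ≃ₜ V₂ × S¹` over `V₂`. [cite: HatcherAT2002, Example 4.45] -/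
def triv₂ : ↥(hopf ⁻¹' V₂) ≃ₜ ↥V₂ × Circle where
  toFun := triv₂Fun
  invFun := triv₂Inv
  left_inv := triv₂_left_inv
  right_inv := triv₂_right_inv
  continuous_toFun := continuous_triv₂Fun
  continuous_invFun := continuous_triv₂Inv

/-! ### The Hopf bundle -/

/-- **The Hopf map is a fibre bundle with fibre `S¹`** (Hatcher 2002, Example 4.45: "the projection `S³ → S²` is a fiber bundle with fiber `S¹`"; two charts, `S²` minus either pole). [cite: HatcherAT2002, Example 4.45] -/
theorem isFibreBundleWith_hopf : IsFibreBundleWith Circle hopf := by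
  refine ⟨hopf.continuous, fun b => ?_⟩
  by_cases hb : -1 < (b : 𝔼 3) 2
  · exact ⟨V₁, isOpen_V₁, hb, triv₁, fun _ => rfl⟩
  · refine ⟨V₂, isOpen_V₂, ?_, triv₂, fun _ => rfl⟩
    show (b : 𝔼 3) 2 < 1
    linarith [not_lt.1 hb]

/-- The Hopf map is a Serre fibration. [cite: HatcherAT2002, Prop. 4.48] -/
theorem isSerreFibration_hopf : IsSerreFibration hopf :=
  isFibreBundleWith_hopf.isSerreFibration

/-- **The fibres of the Hopf map are circles.** [cite: HatcherAT2002, Example 4.45] -/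
theorem nonempty_fibre_homeomorph (x₀ : 𝕊 3) : Nonempty (↥(fibre hopf x₀) ≃ₜ Circle) :=
  isFibreBundleWith_hopf.nonempty_fibre_homeomorph (hopf x₀)

/-- **`πₙ(S¹) = 0` for `n ≥ 2`** on Mathlib's unit circle `Circle ⊂ ℂ` (transport of
`AddCircle.subsingleton_homotopyGroup` along `AddCircle.homeomorphCircle'`). [cite: HatcherAT2002, Prop. 4.1] -/
theorem Circle.subsingleton_homotopyGroup {N : Type*} [DecidableEq N] [Fintype N] (hN : 2 ≤ Fintype.card N)
    (u : Circle) : Subsingleton (HomotopyGroup N Circle u) := by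
  let e : AddCircle (2 * Real.pi) ≃ₜ Circle := AddCircle.homeomorphCircle'
  obtain ⟨t, rfl⟩ := e.surjective u
  haveI := AddCircle.subsingleton_homotopyGroup hN t
  exact (Equiv.ofBijective _ (bijective_homotopyGroupMap_homeomorph (N := N) e t)).symm.subsingleton

/-- `π_N` of the fibres of `η` vanish for `|N| ≥ 2` (they are circles, `πₙ(S¹) = 0` for `n ≥ 2`).
[cite: HatcherAT2002, Prop. 4.1, Example 4.45] -/
theorem subsingleton_homotopyGroup_fibre {N : Type*} [DecidableEq N] [Fintype N] (hN : 2 ≤ Fintype.card N)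
    (x₀ : 𝕊 3) (a : ↥(fibre hopf x₀)) : Subsingleton (HomotopyGroup N ↥(fibre hopf x₀) a) := by
  obtain ⟨e⟩ := nonempty_fibre_homeomorph x₀
  haveI := Circle.subsingleton_homotopyGroup hN (e a)
  exact (Equiv.ofBijective _ (bijective_homotopyGroupMap_homeomorph (N := N) e a)).subsingleton

/-- **`η_* : πₙ(S³) → πₙ(S²)` is a bijection for `n ≥ 3`** (the long exact sequence of the Hopf
bundle with `πₙ(S¹) = πₙ₋₁(S¹) = 0`; Hatcher 2002, Example 4.45 with Thm. 4.41: "`πₙ(S³) ≈ πₙ(S²)`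
for `n ≥ 3`"; in particular `π₃(S²) ≅ π₃(S³)`). [cite: HatcherAT2002, Example 4.45, Thm. 4.41] -/
theorem bijective_homotopyGroupMap_hopf {N : Type*} [DecidableEq N] [Fintype N] (hN : 3 ≤ Fintype.card N)
    (x₀ : 𝕊 3) : Bijective (homotopyGroupMap (N := N) hopf x₀) := by
  obtain ⟨s, s', hss'⟩ : ∃ s s' : N, s ≠ s' := Fintype.exists_pair_of_one_lt_card (by omega)
  haveI : Nonempty N := ⟨s⟩
  haveI : Nonempty { j // j ≠ s } := ⟨⟨s', fun h => hss' h.symm⟩⟩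
  have hcard : 2 ≤ Fintype.card { j // j ≠ s } := by
    simp only [ne_eq, Fintype.card_subtype_compl, Fintype.card_subtype_eq]; omega
  exact isSerreFibration_hopf.bijective_homotopyGroupMap_of_subsingleton s x₀
    (subsingleton_homotopyGroup_fibre (by omega) x₀ _) (subsingleton_homotopyGroup_fibre hcard x₀ _)

/-- **`η_* : πₙ(S³) → πₙ(S²)` is one-to-one for `n ≥ 2`** (`πₙ(S¹) = 0`). [cite: HatcherAT2002, Example 4.45, Thm. 4.41] -/
theorem injective_homotopyGroupMap_hopf {N : Type*} [DecidableEq N] [Fintype N] (hN : 2 ≤ Fintype.card N)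
    (x₀ : 𝕊 3) : Injective (homotopyGroupMap (N := N) hopf x₀) := by
  obtain ⟨s, s', hss'⟩ : ∃ s s' : N, s ≠ s' := Fintype.exists_pair_of_one_lt_card (by omega)
  haveI : Nonempty N := ⟨s⟩
  haveI := subsingleton_homotopyGroup_fibre hN x₀ (fibreBase hopf x₀)
  -- a homomorphism with trivial kernel
  have hker : ∀ b : HomotopyGroup N (𝕊 3) x₀, homotopyGroupMap (N := N) hopf x₀ b = ⟦GenLoop.const⟧ →
      b = ⟦GenLoop.const⟧ := fun b hb => by
    obtain ⟨c, rfl⟩ := isSerreFibration_hopf.exists_homotopyGroupIncl_eq s x₀ b hb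
    rw [Subsingleton.elim c ⟦GenLoop.const⟧]
    rfl
  intro a b hab
  have h1 : homotopyGroupMap (N := N) hopf x₀ (a⁻¹ * b) = ⟦GenLoop.const⟧ := by
    rw [← coe_homotopyGroupMapHom, map_mul, map_inv, coe_homotopyGroupMapHom, hab, inv_mul_cancel,
      HomotopyGroup.one_def]
  have h2 := hker _ h1
  rw [← HomotopyGroup.one_def] at h2
  exact inv_mul_eq_one.1 h2

end HopfFibration

end Literature.AlgebraicTopology.Homotopy

end
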